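import Mathlib.Data.Finset.Prod
import Mathlib.Data.Fintype.Pi
import Mathlib.Data.Fintype.Prod
import Mathlib.Logic.Equiv.Prod
import Literature.Combinatorics.Digraph.RivasseauBalancedSubgraphs
import HarnessLib

/-!
# Lieb's orientation count: Rivasseau's lemma summed over the orientations of a separated family of pairs

E. H. Lieb, *A refinement of Simon's correlation inequality*, Comm. Math. Phys. **77** (1980) 127–135 [Lieb1980],
p. 132–133: the plane-rotor inequality (23), `⟨σ_a·σ_c⟩_{A+C} ≤ ∑_{b ∈ B} ⟨σ_a·σ_b⟩_A ⟨σ_b·σ_c⟩_{A+C}`, reduces,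
after expanding the Gibbs weights in powers of the couplings and every `cos` into its two orientations, to a
statement about directed graphs ("the graphical exercise", (24)–(27)), which Lieb derived from his digraph conjecture,
proved by V. Rivasseau, Comm. Math. Phys. **77** (1980) 145–147 [Rivasseau1980] (tree:
`Literature.Combinatorics.Digraph.card_balanced_le_sum_card`).

This file carries out that purely combinatorial summation, in the form consumed by the analytic part
(`PlaneRotatorLiebRivasseauProof.lean`). Data: `N` Taylor factors with underlying pairs `g : Fin N → V × V`; a set
`Apos` of positions carrying bonds of the INSIDE system `A` (both endpoints in `A`), the other positions carrying
bonds of `C` (both endpoints in `C`); vertices `a ∈ A`, `c ∈ C`. For a set `S ⊆ Apos` of inside factors assigned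
to the partition function `Z_A` and an orientation of all factors, the relevant numbers are the counts of
orientations `τ` of the factors in `S` with prescribed valence and of orientations of the remaining factors with
prescribed valence (`Fin N → Bool` split along `S`, `card_mul_card_eq_card_filter_and`). The theorem
`lieb_orientation_count_le`:

  `∑_{S ⊆ Apos} #{τ_S balanced} · #{τ_{Sᶜ} : valence = e_a − e_c}
      ≤ ∑_{b ∈ A ∩ C} ∑_{S ⊆ Apos} #{τ_S : valence = e_a − e_b} · #{τ_{Sᶜ} : valence = e_b − e_c}`,

obtained by regrouping both sides as sums over total orientations `σ` with total valence `e_a − e_c` of the number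
of subsets `S ⊆ Apos` with `valence_σ(S) = 0`, resp. `= e_a − e_b`, and applying Rivasseau's lemma to the digraph
of inside arrows (`card_balanced_le_sum_card_of_separated`: its vertices of negative valence lie in `A ∩ C` because
the `C`-arrows do not touch `V ∖ C` and the total valence is `e_a − e_c`; when `a ∈ C` the term `b = a` suffices).

Pure finite combinatorics. Not here: the measure-theoretic expansion (next file).
-/

namespace Literature.Combinatorics.Digraph

open Finset

variable {V : Type*} [Fintype V] [DecidableEq V] {N : ℕ}

/-! ### Splitting orientations along a set of positions -/

omit [Fintype V] in
/-- The valence of the sub-family indexed by `S`, oriented by the restriction of `σ`, is the valence of `S`.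
[cite: Lieb1980, p. 133 (directed graphs from the expansion)] -/
theorem valence_orient_restrict (g : Fin N → V × V) (S : Finset (Fin N)) (σ : Fin N → Bool) :
    valence (orient (fun j : S => g j) fun j : S => σ j) Finset.univ = valence (orient g σ) S := by
  rw [valence_orient, valence_orient]
  exact Finset.sum_coe_sort S (fun j => if σ j then arrowCharge (g j) else -arrowCharge (g j))

omit [Fintype V] in
/-- The valence of the complementary sub-family, oriented by the restriction of `σ`, is the valence of the
complement. [cite: Lieb1980, p. 133 (directed graphs from the expansion)] -/
theorem valence_orient_restrict_compl (g : Fin N → V × V) (S : Finset (Fin N)) (σ : Fin N → Bool) :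
    valence (orient (fun j : {j // j ∉ S} => g j) fun j : {j // j ∉ S} => σ j) Finset.univ =
      valence (orient g σ) (Finset.univ \ S) := by
  rw [valence_orient, valence_orient]
  exact (Finset.sum_subtype (p := fun j : Fin N => j ∉ S) (Finset.univ \ S) (fun j => by simp)
    (fun j => if σ j then arrowCharge (g j) else -arrowCharge (g j))).symm

/-- **Product of counts = joint count.** The number of orientations of the factors in `S` with valence `q₁` times
the number of orientations of the remaining factors with valence `q₂` is the number of orientations `σ` of all
factors with `valence_σ(S) = q₁` and `valence_σ(Sᶜ) = q₂` (orientations of disjoint families are independent).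
[cite: Lieb1980, p. 133 (the graphical exercise)] -/
theorem card_mul_card_eq_card_filter_and (g : Fin N → V × V) (S : Finset (Fin N)) (q₁ q₂ : V → ℤ) :
    (Finset.univ.filter fun τ : S → Bool => valence (orient (fun j : S => g j) τ) Finset.univ = q₁).card *
      (Finset.univ.filter fun τ : {j // j ∉ S} → Bool =>
        valence (orient (fun j : {j // j ∉ S} => g j) τ) Finset.univ = q₂).card =
    (Finset.univ.filter fun σ : Fin N → Bool =>
      valence (orient g σ) S = q₁ ∧ valence (orient g σ) (Finset.univ \ S) = q₂).card := by
  rw [← Finset.card_product, ← Finset.filter_product, Finset.univ_product_univ]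
  symm
  refine Finset.card_equiv (Equiv.piEquivPiSubtypeProd (fun j => j ∈ S) fun _ => Bool) fun σ => ?_
  simp only [Finset.mem_filter, Finset.mem_univ, true_and, Equiv.piEquivPiSubtypeProd_apply]
  rw [valence_orient_restrict, valence_orient_restrict_compl]

omit [Fintype V] [DecidableEq V] in
/-- Regrouping a sum of joint counts as a sum over total orientations:
`∑_{S ∈ 𝒮} #{σ : P S σ ∧ R σ} = ∑_σ [R σ] · #{S ∈ 𝒮 : P S σ}`. [folklore] -/
private theorem sum_card_filter_and_eq (𝒮 : Finset (Finset (Fin N))) (P : Finset (Fin N) → (Fin N → Bool) → Prop)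
    (R : (Fin N → Bool) → Prop) [∀ S σ, Decidable (P S σ)] [∀ σ, Decidable (R σ)] :
    ∑ S ∈ 𝒮, (Finset.univ.filter fun σ : Fin N → Bool => P S σ ∧ R σ).card =
      ∑ σ : Fin N → Bool, if R σ then (𝒮.filter fun S => P S σ).card else 0 := by
  simp only [Finset.card_filter]
  rw [Finset.sum_comm]
  refine Finset.sum_congr rfl fun σ _ => ?_
  split_ifs with h
  · exact Finset.sum_congr rfl fun S _ => by simp [h]
  · exact Finset.sum_eq_zero fun S _ => by simp [h]

omit [Fintype V] in
/-- `valence(S) = q₁ ∧ valence(Sᶜ) = q₂` iff `valence(S) = q₁ ∧ valence(all) = q₁ + q₂`. [folklore] -/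
private theorem and_iff_and_univ (d : Fin N → V × V) (S : Finset (Fin N)) (q₁ q₂ : V → ℤ) :
    (valence d S = q₁ ∧ valence d (Finset.univ \ S) = q₂) ↔
      (valence d S = q₁ ∧ valence d Finset.univ = q₁ + q₂) := by
  have h := valence_add_valence_sdiff d (Finset.subset_univ S)
  constructor
  · rintro ⟨h1, h2⟩
    exact ⟨h1, by rw [← h, h1, h2]⟩
  · rintro ⟨h1, h2⟩
    refine ⟨h1, ?_⟩
    rw [h1, h2] at h
    exact add_left_cancel h

/-! ### Rivasseau's lemma on the digraph of inside arrows -/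

omit [Fintype V] in
/-- An oriented pair contributes no charge at a vertex which is not one of its endpoints. [cite: Lieb1980, p. 133 (directed graphs from the expansion)] -/
theorem arrowCharge_orient_apply_eq_zero {α : Type*} (g : α → V × V) (σ : α → Bool) (j : α) {x : V}
    (h1 : (g j).1 ≠ x) (h2 : (g j).2 ≠ x) : arrowCharge (orient g σ j) x = 0 := by
  rw [arrowCharge_apply, orient]
  split_ifs with h <;> simp_all

/-- **The valence structure of a separated family** (Lieb's setting `H_{A+C} = H_A + H_C`): if the pairs at the
positions of `Apos` have both endpoints in `A`, the others both endpoints in `C`, `a ∈ A ∖ C`, `c ∈ C`, and an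
orientation `σ` has total valence `e_a − e_c`, then in the digraph of the `Apos`-arrows the vertex `a` has valence
`+1` and every vertex of negative valence lies in `A ∩ C`; hence (Rivasseau) the number of its balanced subgraphs
is at most `∑_{b ∈ A ∩ C} #{S ⊆ Apos : valence_σ(S) = e_a − e_b}`. The same bound holds trivially when `a ∈ C`
(term `b = a`). [cite: Lieb1980, eq. (24) and p. 133 (conjecture ⇒ (10))] -/
theorem card_balanced_le_sum_card_of_separated (g : Fin N → V × V) (Apos : Finset (Fin N)) (A C : Finset V)
    (a c : V) (hA : ∀ j ∈ Apos, (g j).1 ∈ A ∧ (g j).2 ∈ A) (hC : ∀ j, j ∉ Apos → (g j).1 ∈ C ∧ (g j).2 ∈ C)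
    (ha : a ∈ A) (hc : c ∈ C) (σ : Fin N → Bool)
    (hσ : valence (orient g σ) Finset.univ = Pi.single a 1 - Pi.single c 1) :
    (balanced (orient g σ) Apos).card ≤
      ∑ b ∈ A ∩ C, (Apos.powerset.filter fun S =>
        valence (orient g σ) S = Pi.single a 1 - Pi.single b 1).card := by
  by_cases haC : a ∈ C
  · have hmem : a ∈ A ∩ C := Finset.mem_inter.2 ⟨ha, haC⟩
    refine le_trans (le_of_eq ?_) (Finset.single_le_sum (f := fun b => (Apos.powerset.filter fun S =>
      valence (orient g σ) S = Pi.single a 1 - Pi.single b 1).card) (fun _ _ => Nat.zero_le _) hmem)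
    simp only [balanced, sub_self]
  · set d := orient g σ with hd
    have hsplit : ∀ x, valence d Apos x + valence d (Finset.univ \ Apos) x =
        (if x = a then 1 else 0) - (if x = c then 1 else 0) := by
      intro x
      have := congrFun (valence_add_valence_sdiff d (Finset.subset_univ Apos)) x
      rw [Pi.add_apply, hd, hσ, Pi.sub_apply, Pi.single_apply, Pi.single_apply] at this
      rw [hd]
      exact this
    have hCzero : ∀ x, x ∉ C → valence d (Finset.univ \ Apos) x = 0 := by
      intro x hx
      rw [valence_apply]
      refine Finset.sum_eq_zero fun j hj => ?_
      have hj' : j ∉ Apos := (Finset.mem_sdiff.1 hj).2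
      exact arrowCharge_orient_apply_eq_zero g σ j (fun h => hx (h ▸ (hC j hj').1))
        (fun h => hx (h ▸ (hC j hj').2))
    have hAzero : ∀ x, x ∉ A → valence d Apos x = 0 := by
      intro x hx
      rw [valence_apply]
      refine Finset.sum_eq_zero fun j hj => ?_
      exact arrowCharge_orient_apply_eq_zero g σ j (fun h => hx (h ▸ (hA j hj).1))
        (fun h => hx (h ▸ (hA j hj).2))
    have hac : a ≠ c := fun h => haC (h ▸ hc)
    have hv : 0 < valence d Apos a := by
      have h1 := hsplit a
      rw [hCzero a haC, if_pos rfl, if_neg hac] at h1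
      linarith
    have hB : ∀ x, valence d Apos x < 0 → x ∈ A ∩ C := by
      intro x hx
      rw [Finset.mem_inter]
      constructor
      · by_contra hxA
        rw [hAzero x hxA] at hx
        exact lt_irrefl _ hx
      · by_contra hxC
        have h1 := hsplit x
        have hxc : x ≠ c := fun h => hxC (h ▸ hc)
        rw [hCzero x hxC, if_neg hxc] at h1
        split_ifs at h1 <;> linarith
    exact card_balanced_le_sum_card Apos d a hv (A ∩ C) hB

/-! ### The summed inequality -/

/-- **Lieb's orientation count** (the combinatorial content of Lieb 1980 (23)–(27) with Rivasseau's lemma). For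
`N` pairs `g : Fin N → V × V`, positions `Apos` carrying pairs inside `A` and the others pairs inside `C`,
`a ∈ A`, `c ∈ C`:

  `∑_{S ⊆ Apos} #{τ_S : valence 0} · #{τ_{Sᶜ} : valence e_a − e_c}
    ≤ ∑_{b ∈ A ∩ C} ∑_{S ⊆ Apos} #{τ_S : valence e_a − e_b} · #{τ_{Sᶜ} : valence e_b − e_c}`,

where `τ_S` ranges over the orientations of the pairs at the positions of `S` and `τ_{Sᶜ}` over those of the
remaining pairs. These are, up to the common factor `2^{−N} ∏ J`, the Taylor coefficients of
`Z_A · Z_{A+C}⟨cos(θ_a − θ_c)⟩_{A+C}` and of `∑_b Z_A⟨cos(θ_a − θ_b)⟩_A · Z_{A+C}⟨cos(θ_b − θ_c)⟩_{A+C}`.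
[cite: Lieb1980, eqs. (23)–(24) with the Conjecture p. 133; Rivasseau1980 Lemma] -/
theorem lieb_orientation_count_le (g : Fin N → V × V) (Apos : Finset (Fin N)) (A C : Finset V) (a c : V)
    (hA : ∀ j ∈ Apos, (g j).1 ∈ A ∧ (g j).2 ∈ A) (hC : ∀ j, j ∉ Apos → (g j).1 ∈ C ∧ (g j).2 ∈ C)
    (ha : a ∈ A) (hc : c ∈ C) :
    ∑ S ∈ Apos.powerset,
        (Finset.univ.filter fun τ : S → Bool => valence (orient (fun j : S => g j) τ) Finset.univ = 0).card *
          (Finset.univ.filter fun τ : {j // j ∉ S} → Bool =>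
            valence (orient (fun j : {j // j ∉ S} => g j) τ) Finset.univ = Pi.single a 1 - Pi.single c 1).card ≤
      ∑ b ∈ A ∩ C, ∑ S ∈ Apos.powerset,
        (Finset.univ.filter fun τ : S → Bool =>
            valence (orient (fun j : S => g j) τ) Finset.univ = Pi.single a 1 - Pi.single b 1).card *
          (Finset.univ.filter fun τ : {j // j ∉ S} → Bool =>
            valence (orient (fun j : {j // j ∉ S} => g j) τ) Finset.univ = Pi.single b 1 - Pi.single c 1).card := by
  simp_rw [card_mul_card_eq_card_filter_and]
  -- rewrite the joint conditions through the total valence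
  have hL : ∀ S : Finset (Fin N), (Finset.univ.filter fun σ : Fin N → Bool =>
      valence (orient g σ) S = 0 ∧ valence (orient g σ) (Finset.univ \ S) = Pi.single a 1 - Pi.single c 1) =
      Finset.univ.filter fun σ : Fin N → Bool =>
        valence (orient g σ) S = 0 ∧ valence (orient g σ) Finset.univ = Pi.single a 1 - Pi.single c 1 := by
    intro S
    refine Finset.filter_congr fun σ _ => ?_
    rw [and_iff_and_univ, zero_add]
  have hR : ∀ (b : V) (S : Finset (Fin N)), (Finset.univ.filter fun σ : Fin N → Bool =>
      valence (orient g σ) S = Pi.single a 1 - Pi.single b 1 ∧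
        valence (orient g σ) (Finset.univ \ S) = Pi.single b 1 - Pi.single c 1) =
      Finset.univ.filter fun σ : Fin N → Bool =>
        valence (orient g σ) S = Pi.single a 1 - Pi.single b 1 ∧
          valence (orient g σ) Finset.univ = Pi.single a 1 - Pi.single c 1 := by
    intro b S
    refine Finset.filter_congr fun σ _ => ?_
    rw [and_iff_and_univ, sub_add_sub_cancel]
  simp_rw [hL, hR]
  have h1 := sum_card_filter_and_eq Apos.powerset (fun S σ => valence (orient g σ) S = 0)
    (fun σ => valence (orient g σ) Finset.univ = Pi.single a 1 - Pi.single c 1)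
  have h2 := fun b : V => sum_card_filter_and_eq Apos.powerset
    (fun S σ => valence (orient g σ) S = Pi.single a 1 - Pi.single b 1)
    (fun σ => valence (orient g σ) Finset.univ = Pi.single a 1 - Pi.single c 1)
  beta_reduce at h1 h2
  rw [h1]
  simp_rw [h2]
  rw [Finset.sum_comm]
  refine Finset.sum_le_sum fun σ _ => ?_
  split_ifs with hσ
  · exact card_balanced_le_sum_card_of_separated g Apos A C a c hA hC ha hc σ hσ
  · exact Nat.zero_le _

end Literature.Combinatorics.Digraph
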